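import Mathlib
import Summits.Ventures.LatticeQCDFlow.Scaling.GroupLayerHaar
import Summits.Ventures.LatticeQCDFlow.Scaling.U1LayerWords
import Literature.MathematicalPhysics.QuantumLattice.GaugeGroups
import Literature.MathematicalPhysics.QuantumFieldTheory.Balaban1983to89.InfiniteVolumeSufficientXX

/-!
# LatticeQCDFlow / Scaling — the one-link data of compact `U(1)`: `θ = 1/2`

HONEST FRAMING: exact (Metropolis-corrected) sampling algorithms for lattice gauge theory;
figures of merit are autocorrelation/cost numbers at stated couplings and volumes; no
continuum-physics claim.

Venture `LatticeQCDFlow` (cell pub-lqcd), topic `Scaling`, FANOUT row 30 (lean-1) — OUR WORK, a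
consistency file of the extension of the slab-chain proof of (LC)/(U′) to general gauge groups:
the hypothesis `OneLink ρ θ` of `Scaling/GroupLayerHaar.lean` DISCHARGED for `G = U(1)` (Mathlib's
`Circle`) and its defining representation `u1Rep` (`Literature…GaugeGroups`) with `θ = 1/2`
(`oneLink_u1Rep`): `tr u1Rep(z⁻¹) = conj z`, `∫ Re z = 0`, `∫ Re z · z = (∫ z² + ∫ 1)/2 = 1/2`
by the characters of the circle (`integral_coe_zpow_haarProbability_circle`; the character identity `trace_u1Rep` is the tree's, `Balaban1983to89/InfiniteVolumeSufficientXX`).  With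
`Scaling/GroupCrossCutFloorAllT.lean` this re-derives gen-9's `U(1)` result
(`U1Layer.crossCutCorrelatorFloor_u1_all`, leading tube `1 · (1/2)^{4t+1} = 2^{-(4t+1)}`
[cite: MontvayMunster1994, §3.6.2 (3.437)]) from the group-generic theorem.  Elementary; nothing
is cited as a fact; no `def`, no `sorry`.
-/

noncomputable section

open MeasureTheory Filter Finset
open Literature.MathematicalPhysics.QuantumFieldTheory
open Literature.MathematicalPhysics.QuantumLattice (u1Rep u1Rep_apply continuous_u1Rep
  integral_coe_zpow_haarProbability_circle)

namespace Summit.Ventures.LatticeQCDFlow.Theory2.GroupLayer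

/-- `Re tr u1Rep(z) = Re z`. [folklore] -/
theorem trRe_u1Rep (z : Circle) : trRe u1Rep z = (z : ℂ).re := by
  rw [trRe, trace_u1Rep]

/-- The coercion `Circle → ℂ` is continuous (domain pinned as `Circle`). [folklore] -/
theorem continuous_coe_circle : Continuous (fun z : Circle => (z : ℂ)) := continuous_subtype_val

/-- Integer powers of the coordinate are Haar integrable on `U(1)`. [folklore] -/
theorem integrable_coe_zpow_circle (n : ℤ) :
    Integrable (fun z : Circle => (z : ℂ) ^ n) (haarProbability Circle) :=
  (continuous_coe_circle.zpow₀ n fun z => Or.inl (Circle.coe_ne_zero z)).integrable_of_hasCompactSupport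
    (HasCompactSupport.of_compactSpace _)

/-- `Re z = (z + z⁻¹)/2` on the circle, as a complex number, with integer powers. [folklore] -/
theorem re_coe_circle_eq (z : Circle) :
    (((z : ℂ).re : ℝ) : ℂ) = 2⁻¹ * ((z : ℂ) ^ (1 : ℤ) + (z : ℂ) ^ (-1 : ℤ)) := by
  rw [zpow_one, zpow_neg_one, ← Circle.coe_inv, Circle.coe_inv_eq_conj, Complex.add_conj]
  push_cast
  ring

/-- `∫ Re z dz = 0` on `U(1)`. [folklore] -/
theorem integral_re_circle : ∫ z, (z : ℂ).re ∂haarProbability Circle = 0 := by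
  have h1 := integral_coe_zpow_haarProbability_circle 1
  have hm1 := integral_coe_zpow_haarProbability_circle (-1)
  simp only [one_ne_zero, if_false] at h1
  simp only [show (-1 : ℤ) ≠ 0 by norm_num, if_false] at hm1
  apply Complex.ofReal_injective
  rw [← integral_complex_ofReal]
  simp_rw [re_coe_circle_eq]
  rw [integral_const_mul, integral_add (integrable_coe_zpow_circle 1) (integrable_coe_zpow_circle (-1)),
    h1, hm1]
  simp

/-- `∫ Re z · z dz = 1/2` on `U(1)`. [folklore] -/
theorem integral_re_mul_coe_circle :
    ∫ z, (((z : ℂ).re : ℝ) : ℂ) * (z : ℂ) ∂haarProbability Circle = 1 / 2 := by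
  have h2 := integral_coe_zpow_haarProbability_circle 2
  have h0 := integral_coe_zpow_haarProbability_circle 0
  simp only [show (2 : ℤ) ≠ 0 by norm_num, if_false] at h2
  simp only [if_true] at h0
  have hpt : ∀ z : Circle, (((z : ℂ).re : ℝ) : ℂ) * (z : ℂ) =
      2⁻¹ * ((z : ℂ) ^ (2 : ℤ) + (z : ℂ) ^ (0 : ℤ)) := by
    intro z
    rw [re_coe_circle_eq]
    have hz : (z : ℂ) ≠ 0 := Circle.coe_ne_zero z
    rw [zpow_one, zpow_neg_one, zpow_zero, zpow_two]
    field_simp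
  simp_rw [hpt]
  rw [integral_const_mul, integral_add (integrable_coe_zpow_circle 2) (integrable_coe_zpow_circle 0),
    h2, h0]
  norm_num

/-- **THE ONE-LINK DATA OF `U(1)`**: `OneLink u1Rep (1/2)`. [folklore] -/
theorem oneLink_u1Rep : OneLink (G := Circle) u1Rep (1 / 2) := by
  refine ⟨continuous_u1Rep, fun z => ?_, ?_, fun a b => ?_⟩
  · rw [trace_u1Rep, trace_u1Rep, Circle.coe_inv_eq_conj, Complex.star_def]
  · simp_rw [trRe_u1Rep]
    exact integral_re_circle
  · obtain rfl : a = 0 := Subsingleton.elim _ _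
    obtain rfl : b = 0 := Subsingleton.elim _ _
    rw [if_pos rfl]
    have hpt : ∀ z : Circle, (trRe u1Rep z : ℂ) * u1Rep z 0 0 = (((z : ℂ).re : ℝ) : ℂ) * (z : ℂ) := by
      intro z
      rw [trRe_u1Rep, u1Rep_apply]
      simp
    simp_rw [hpt]
    rw [integral_re_mul_coe_circle]
    push_cast
    ring

end Summit.Ventures.LatticeQCDFlow.Theory2.GroupLayer

end
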